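import Literature.NumberTheory.EllipticCurves.HeegnerPointsKolyvaginCebotarevProofs
import Literature.NumberTheory.EllipticCurves.ZpExtensionProofs
import Literature.NumberTheory.GaloisRepresentations.AbsGaloisOuterConj
import Literature.NumberTheory.EllipticCurves.PlaceOverInertiaOrbitProofs
import Literature.NumberTheory.GaloisRepresentations.ModPCyclotomicCharacterInertiaSurjective
import HarnessLib

/-!
# Inertia groups under transport of structure: three generic Galois lemmas

Cell `b2b-bsdres`, team x11b3 (N8/O2), `h44` programme — (P4-C) FILE 2a of x11b3-p4 GEN 6 (the
generic half of the instantiation of `X11b/NoTorsionOfIrreducible.lean` at ring class fields).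
Summit-side THEOREM-ONLY file (no definition, no named fact, no `sorry`); p-free; nothing is
specific to elliptic curves.  HONEST FRAMING: Galois-theoretic plumbing only (folklore; Neukirch,
*ANT*, Ch. I §9); nothing is discharged on the residual map; nothing booked.

The tree moves absolute Galois groups between algebraic closures by `absGaloisTransport`
(`Γ_K ≃* Aut_K(L̄)`, `g ↦ e g e⁻¹`, `e = absClosureEquiv K L`; `ZpExtensionProofs`) and knows that
inertia at a place unramified in a finite NORMAL `M/k` fixes `M` — but only inside
`AlgebraicClosure k` (`smul_eq_of_mem_inertia_of_isUnramifiedIn`).  This file supplies the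
missing glue lemmas (conjugation of inertia, `I_{g𝔓} = g I_𝔓 g⁻¹`, is the tree's
`Ideal.conj_mem_inertia_smul_iff`, `AbsGaloisOuterConj`):

* **`smul_eq_of_mem_inertia_of_isUnramifiedIn'`** — the same unramifiedness lemma for an ARBITRARY
  field `Ω ⊇ k` in place of `AlgebraicClosure k`: for `M/k` finite normal with `emb : M →ₐ[k] Ω`,
  a prime `𝔓` of `integralClosure (𝓞 k) Ω` over a place `w` unramified in `M`, every
  `i ∈ 𝔓.inertia (Ω ≃ₐ[k] Ω)` fixes `emb(M)` pointwise (proof = the tree's, verbatim: the image of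
  `i` in `Gal(M/k)` lies in the inertia group of `emb⁻¹𝔓 ∩ 𝓞 M`, which has `e = 1` element;
  Mathlib `Ideal.card_inertia_eq_ramificationIdxIn`);
* **`exists_prime_forall_absGaloisTransport_mem_inertia`** — TRANSPORT: for `L/K` algebraic and a
  prime `𝔓` of `\bar ℤ_K = absIntegers (𝓞 K) K` above `v`, there is a prime `𝔓'` of
  `integralClosure (𝓞 K) L̄` above `v` with `absGaloisTransport (I_𝔓) ≤ I_{𝔓'}`
  (`𝔓' = e(𝔓)`, written as a preimage under `e⁻¹`);
* **`exists_mem_inertia_smul_ne`** — for an odd prime `p`: an element of `Γ_ℚ` in the inertia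
  group of a prime of `\bar ℤ` above `p` that MOVES a `p`-th root of unity (a local inertia element
  with mod-`p` cyclotomic character `-1`, Serre *Local Fields* IV §4 via the tree's
  `Rat.exists_mem_absInertia_adicCompletion_modPCyclotomicCharacterZMod_eq`, restricted along
  `ℚ̄ → ℚ̄_p`, tree `resGalOfEmb_mem_inertia_primeBelow`);
* **`exists_prime_over_forall_mem_inertia_of_restrictScalars`** — RE-BASING along a tower
  `k₀ ⊂ k ⊂ Ω` of the coefficient ring of the integral closure (`integralClosure (𝓞 k₀) Ω` and
  `integralClosure (𝓞 k) Ω` have the same elements): a prime over `v₀` of the former gives a prime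
  of the latter over a place `w` of `k` above `v₀`, with the same inertia condition for every
  `k`-automorphism read as a `k₀`-automorphism.

## References

* [NeukirchANT1999] J. Neukirch, *Algebraic Number Theory*, Ch. I §9 ((9.4)–(9.6): decomposition and
  inertia groups, their behaviour under conjugation and in towers), Ch. II (9.6).
* [SerreLocalFields1979] J.-P. Serre, *Local Fields*, Ch. IV §4, Prop. 17–18 (`χ̄_p(I_p) = 𝔽_pˣ`).

## Mathlib / tree search

Tree: `smul_eq_of_mem_inertia_of_isUnramifiedIn` (`HeegnerPointsKolyvaginCebotarevProofs`),
`absGaloisTransport`, `absGaloisTransport_apply`, `absClosureEquiv` (`ZpExtensionProofs`),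
`absIntegers`, `primesAbove`, `mem_primesAbove_iff` (`IntegralGaloisAction`).  Mathlib:
`Ideal.inertia` / `AddSubgroup.mem_inertia`, `Ideal.card_inertia_eq_ramificationIdxIn`,
`Ideal.ramificationIdxIn_eq_ramificationIdx`, `Ideal.ramificationIdx_eq_one_iff`,
`AlgEquiv.restrictNormal_commutes`, `Ideal.comap_isPrime`, `Ideal.smul_mem_pointwise_smul_iff`,
`IsIntegral.map`, `IsIntegral.tower_top`, `isIntegral_trans`.
`lean search 'InertiaTransport|absGaloisTransport_mem_inertia|smul_eq_of_mem_inertia_of_isUnramifiedIn'` →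
only the tree lemma above (INTENT-grep).
-/

noncomputable section

open scoped Classical Pointwise
open NumberField IsDedekindDomain Field
open Literature.NumberTheory.GaloisRepresentations

namespace Summit.BirchSwinnertonDyer.Rank1Residual.X11b.InertiaTransport

/-! ## §1 Inertia at an unramified place fixes a finite normal subextension — arbitrary ambient field -/

section Unramified

variable {k : Type} [Field k] [NumberField k]
variable (M : Type) [Field M] [Algebra k M] [FiniteDimensional k M] [Normal k M]
variable {Ω : Type*} [Field Ω] [Algebra k Ω] (emb : M →ₐ[k] Ω)

/-- **Inertia at a place unramified in a finite normal `M/k` acts trivially on `M`, in any ambient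
field `Ω`.**  For `emb : M → Ω` over `k`, a prime `𝔓` of `integralClosure (𝓞 k) Ω` lying over a
place `w` of `k` unramified in `M`, and `i ∈ I_𝔓 ≤ Aut_k(Ω)`: `i (emb y) = emb y` for all `y ∈ M`.
Proof: the image of `i` in `Gal(M/k)` (`AlgEquiv.restrictNormal`) lies in the inertia group of
`P = emb⁻¹𝔓 ∩ 𝓞 M`, which has `e(P ∣ w) = 1` element (`Ideal.card_inertia_eq_ramificationIdxIn`).
The tree's `smul_eq_of_mem_inertia_of_isUnramifiedIn` is the case `Ω = k̄`.
[cite: NeukirchANT1999, Ch. I §9 (9.6)] -/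
theorem smul_eq_of_mem_inertia_of_isUnramifiedIn' {w : HeightOneSpectrum (𝓞 k)}
    (hunr : Algebra.IsUnramifiedIn (𝓞 M) w.asIdeal)
    {𝔓 : Ideal (integralClosure (𝓞 k) Ω)} (h𝔓 : 𝔓.IsPrime) (h𝔓w : 𝔓.LiesOver w.asIdeal)
    {i : Ω ≃ₐ[k] Ω} (hi : i ∈ 𝔓.inertia (Ω ≃ₐ[k] Ω)) (y : M) :
    i (emb y) = emb y := by
  classical
  haveI := h𝔓
  haveI : IsGalois k M := ⟨⟩
  haveI : NumberField M := NumberField.of_module_finite k M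
  haveI : Module.Finite (𝓞 k) (𝓞 M) := IsIntegralClosure.finite (𝓞 k) k M (𝓞 M)
  haveI : IsGaloisGroup (M ≃ₐ[k] M) (𝓞 k) (𝓞 M) :=
    IsGaloisGroup.of_isFractionRing (M ≃ₐ[k] M) (𝓞 k) (𝓞 M) k M
  set G := M ≃ₐ[k] M
  -- `𝓞 M → integralClosure (𝓞 k) Ω` along `emb`
  let ι : 𝓞 M →+* integralClosure (𝓞 k) Ω :=
    (emb.toRingHom.comp (algebraMap (𝓞 M) M)).codRestrict (integralClosure (𝓞 k) Ω) fun x ↦ by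
      change emb (algebraMap (𝓞 M) M x) ∈ integralClosure (𝓞 k) Ω
      rw [mem_integralClosure_iff]
      have hx : IsIntegral ℤ (emb (algebraMap (𝓞 M) M x)) :=
        (RingOfIntegers.isIntegral_coe x).map (emb.restrictScalars ℤ)
      exact hx.tower_top
  have hιcoe : ∀ x : 𝓞 M, (ι x : Ω) = emb (x : M) := fun _ ↦ rfl
  have hιcomp : ι.comp (algebraMap (𝓞 k) (𝓞 M)) = algebraMap (𝓞 k) (integralClosure (𝓞 k) Ω) := by
    ext r
    change emb ((algebraMap (𝓞 k) (𝓞 M) r : M)) = algebraMap (𝓞 k) Ω r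
    rw [show ((algebraMap (𝓞 k) (𝓞 M) r : M)) = algebraMap k M (r : k) from rfl, emb.commutes,
      IsScalarTower.algebraMap_apply (𝓞 k) k Ω]
  -- the prime `P = 𝔓 ∩ 𝓞 M` below `𝔓`
  set P : Ideal (𝓞 M) := 𝔓.comap ι with hPdef
  haveI hPprime : P.IsPrime := Ideal.comap_isPrime ι 𝔓
  haveI hPover : P.LiesOver w.asIdeal := by
    constructor
    change w.asIdeal = Ideal.comap (algebraMap (𝓞 k) (𝓞 M)) (Ideal.comap ι 𝔓)
    rw [Ideal.comap_comap, hιcomp]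
    exact h𝔓w.over
  haveI : w.asIdeal.IsMaximal := w.isMaximal
  -- the inertia group of `P` in `G` is trivial (unramified)
  have hcard : Nat.card (P.inertia G) = 1 := by
    rw [Ideal.card_inertia_eq_ramificationIdxIn (G := G) w.asIdeal P,
      Ideal.ramificationIdxIn_eq_ramificationIdx w.asIdeal P G]
    exact Ideal.ramificationIdx_eq_one_iff.mpr (hunr P hPprime hPover)
  have hbot : P.inertia G = ⊥ := Subgroup.eq_bot_of_card_eq _ hcard
  -- `M` as a subextension of `Ω` through `emb`, and the image `g` of `i` in `G`
  letI : Algebra M Ω := emb.toRingHom.toAlgebra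
  haveI : IsScalarTower k M Ω :=
    IsScalarTower.of_algebraMap_eq fun x ↦ (emb.commutes x).symm
  set g : G := AlgEquiv.restrictNormal i M with hg
  have hgc : ∀ y : M, emb (g y) = i (emb y) := fun y ↦
    AlgEquiv.restrictNormal_commutes i M y
  have hgI : g ∈ P.inertia G := by
    rw [Ideal.inertia, AddSubgroup.mem_inertia]
    intro b
    change g • b - b ∈ Ideal.comap ι 𝔓
    rw [Ideal.mem_comap, map_sub]
    rw [Ideal.inertia, AddSubgroup.mem_inertia] at hi
    have hgb : ι (g • b) = i • ι b := by
      apply Subtype.ext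
      rw [integralClosure.coe_smul, hιcoe, hιcoe]
      exact hgc b
    rw [hgb]
    exact hi (ι b)
  rw [hbot, Subgroup.mem_bot] at hgI
  have h := hgc y
  rw [hgI, AlgEquiv.one_apply] at h
  exact h.symm

end Unramified

/-! ## §2 Transport along `absGaloisTransport : Γ_K ≃* Aut_K(L̄)` -/

section Transport

variable {K : Type} [Field K] (L : Type) [Field L] [Algebra K L] [Algebra.IsAlgebraic K L]

/-- **Transport of inertia along `absGaloisTransport`.**  For `L/K` algebraic and a prime `𝔓` of
`\bar ℤ_K = absIntegers (𝓞 K) K` above the place `v`, there is a prime `𝔓'` of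
`integralClosure (𝓞 K) L̄` (`L̄ = AlgebraicClosure L`), prime and lying over `v`, such that every
`i ∈ I_𝔓 ≤ Γ_K` is carried by `absGaloisTransport` (`g ↦ e g e⁻¹`, `e = absClosureEquiv K L`) into
`I_{𝔓'}`.  (`𝔓'` = the preimage of `𝔓` under `e⁻¹` restricted to integral elements, i.e. `e(𝔓)`.)
[cite: NeukirchANT1999, Ch. I §9 (9.4)] -/
theorem exists_prime_forall_absGaloisTransport_mem_inertia {v : HeightOneSpectrum (𝓞 K)}
    {𝔓 : Ideal (absIntegers (𝓞 K) K)} (h𝔓 : 𝔓 ∈ v.primesAbove) :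
    ∃ 𝔓' : Ideal (integralClosure (𝓞 K) (AlgebraicClosure L)),
      𝔓'.IsPrime ∧ 𝔓'.LiesOver v.asIdeal ∧
      ∀ i ∈ 𝔓.inertia (absoluteGaloisGroup K),
        Literature.NumberTheory.EllipticCurves.absGaloisTransport (L := L) i ∈
          𝔓'.inertia (AlgebraicClosure L ≃ₐ[K] AlgebraicClosure L) := by
  haveI := h𝔓.1
  set e := Literature.NumberTheory.EllipticCurves.absClosureEquiv K L with he
  -- `e⁻¹` on integral elements
  let φ : integralClosure (𝓞 K) (AlgebraicClosure L) →+* absIntegers (𝓞 K) K :=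
    (e.symm.toAlgHom.toRingHom.comp (Subalgebra.val _).toRingHom).codRestrict
      (absIntegers (𝓞 K) K) fun y ↦ by
        change e.symm (y : AlgebraicClosure L) ∈ integralClosure (𝓞 K) (AlgebraicClosure K)
        have hy : IsIntegral (𝓞 K) (y : AlgebraicClosure L) := by
          have h := y.2; rwa [mem_integralClosure_iff] at h
        rw [mem_integralClosure_iff]
        exact hy.map (e.symm.toAlgHom.restrictScalars (𝓞 K))
  have hφ : ∀ y : integralClosure (𝓞 K) (AlgebraicClosure L),
      (φ y : AlgebraicClosure K) = e.symm y := fun _ ↦ rfl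
  have hφcomp : φ.comp (algebraMap (𝓞 K) (integralClosure (𝓞 K) (AlgebraicClosure L))) =
      algebraMap (𝓞 K) (absIntegers (𝓞 K) K) := by
    ext r
    change e.symm (algebraMap (𝓞 K) (AlgebraicClosure L) r) = algebraMap (𝓞 K) (AlgebraicClosure K) r
    rw [IsScalarTower.algebraMap_apply (𝓞 K) K (AlgebraicClosure L), e.symm.commutes,
      ← IsScalarTower.algebraMap_apply]
  refine ⟨𝔓.comap φ, Ideal.comap_isPrime φ 𝔓, ?_, ?_⟩
  · constructor
    rw [Ideal.under_def, Ideal.comap_comap, hφcomp]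
    exact h𝔓.2.over
  · intro i hi
    rw [Ideal.inertia, AddSubgroup.mem_inertia] at hi ⊢
    intro y
    change _ ∈ Ideal.comap φ 𝔓
    rw [Ideal.mem_comap, map_sub]
    have key : φ (Literature.NumberTheory.EllipticCurves.absGaloisTransport (L := L) i • y) = i • φ y := by
      apply Subtype.ext
      rw [hφ, integralClosure.coe_smul, integralClosure.coe_smul, hφ, AlgEquiv.smul_def,
        Literature.NumberTheory.EllipticCurves.absGaloisTransport_apply, ← he, AlgEquiv.symm_apply_apply]
    rw [key]
    exact hi (φ y)

end Transport

/-! ## §3 Re-basing the coefficient ring of the integral closure along `k₀ ⊂ k` -/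

section Rebase

variable {k₀ : Type} [Field k₀] {k : Type} [Field k]
  [Algebra k₀ k] {Ω : Type*} [Field Ω] [Algebra k₀ Ω] [Algebra k Ω] [IsScalarTower k₀ k Ω]

/-- **Re-basing a prime of the integral closure along a tower `k₀ ⊂ k ⊂ Ω` of number fields.**
`integralClosure (𝓞 k₀) Ω` and `integralClosure (𝓞 k) Ω` have the same elements; a prime `𝔓₁` of
the former over the place `v₀` of `k₀` gives a prime `𝔓₂` of the latter over a place `w` of `k`
dividing `v₀` (`(w ∩ 𝓞 k₀) = v₀`), such that a `k`-automorphism of `Ω` lies in `I_{𝔓₂}` as soon as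
the `k₀`-automorphism with the same values lies in `I_{𝔓₁}`. [cite: NeukirchANT1999, Ch. I §9] -/
theorem exists_prime_over_forall_mem_inertia_of_restrictScalars {v₀ : HeightOneSpectrum (𝓞 k₀)}
    {𝔓₁ : Ideal (integralClosure (𝓞 k₀) Ω)} (h𝔓₁ : 𝔓₁.IsPrime) (h𝔓₁v : 𝔓₁.LiesOver v₀.asIdeal) :
    ∃ (𝔓₂ : Ideal (integralClosure (𝓞 k) Ω)) (w : HeightOneSpectrum (𝓞 k)),
      𝔓₂.IsPrime ∧ 𝔓₂.LiesOver w.asIdeal ∧ w.asIdeal.under (𝓞 k₀) = v₀.asIdeal ∧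
      ∀ (j : Ω ≃ₐ[k] Ω) (g : Ω ≃ₐ[k₀] Ω), (∀ y : Ω, j y = g y) →
        g ∈ 𝔓₁.inertia (Ω ≃ₐ[k₀] Ω) → j ∈ 𝔓₂.inertia (Ω ≃ₐ[k] Ω) := by
  -- the identity on elements, `integralClosure (𝓞 k) Ω → integralClosure (𝓞 k₀) Ω`
  let ψ : integralClosure (𝓞 k) Ω →+* integralClosure (𝓞 k₀) Ω :=
    ((Subalgebra.val _).toRingHom).codRestrict (integralClosure (𝓞 k₀) Ω) fun y ↦ by
      change (y : Ω) ∈ integralClosure (𝓞 k₀) Ω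
      have h1 : IsIntegral (𝓞 k) (y : Ω) := by
        have h := y.2; rwa [mem_integralClosure_iff] at h
      rw [mem_integralClosure_iff]
      have h2 : IsIntegral ℤ (y : Ω) := isIntegral_trans (R := ℤ) (A := 𝓞 k) _ h1
      exact h2.tower_top
  have hψ : ∀ y : integralClosure (𝓞 k) Ω, (ψ y : Ω) = y := fun _ ↦ rfl
  haveI := h𝔓₁
  set 𝔓₂ : Ideal (integralClosure (𝓞 k) Ω) := 𝔓₁.comap ψ with h𝔓₂
  haveI h2prime : 𝔓₂.IsPrime := Ideal.comap_isPrime ψ 𝔓₁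
  -- `r ∈ 𝓞 k₀` lies under `𝔓₂` iff it lies under `𝔓₁`, i.e. in `v₀`
  have hmem : ∀ r : 𝓞 k₀,
      algebraMap (𝓞 k₀) (𝓞 k) r ∈ 𝔓₂.under (𝓞 k) ↔ r ∈ v₀.asIdeal := by
    intro r
    rw [h𝔓₁v.over]
    simp only [Ideal.under_def, Ideal.mem_comap, h𝔓₂]
    have hval : ψ (algebraMap (𝓞 k) (integralClosure (𝓞 k) Ω) (algebraMap (𝓞 k₀) (𝓞 k) r)) =
        algebraMap (𝓞 k₀) (integralClosure (𝓞 k₀) Ω) r := by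
      apply Subtype.ext
      rw [hψ]
      change algebraMap (𝓞 k) Ω (algebraMap (𝓞 k₀) (𝓞 k) r) = algebraMap (𝓞 k₀) Ω r
      rw [IsScalarTower.algebraMap_apply (𝓞 k) k Ω, IsScalarTower.algebraMap_apply (𝓞 k₀) k₀ Ω,
        IsScalarTower.algebraMap_apply k₀ k Ω,
        ← IsScalarTower.algebraMap_apply (𝓞 k₀) (𝓞 k) k r, IsScalarTower.algebraMap_apply (𝓞 k₀) k₀ k r]
    rw [hval]
  -- the place `w` of `k` under `𝔓₂`
  have hne : 𝔓₂.under (𝓞 k) ≠ ⊥ := by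
    obtain ⟨r, hr, hr0⟩ := Submodule.exists_mem_ne_zero_of_ne_bot v₀.ne_bot
    intro h
    have h1 : algebraMap (𝓞 k₀) (𝓞 k) r ∈ 𝔓₂.under (𝓞 k) := (hmem r).mpr hr
    rw [h, Ideal.mem_bot] at h1
    apply hr0
    have h2 : algebraMap k₀ k (r : k₀) = 0 := by
      have := congrArg (fun x : 𝓞 k ↦ (x : k)) h1
      simpa [IsScalarTower.algebraMap_apply (𝓞 k₀) k₀ k] using
        ((IsScalarTower.algebraMap_apply (𝓞 k₀) (𝓞 k) k r).trans this)
    have h3 : (r : k₀) = 0 := (algebraMap k₀ k).injective (by rw [h2, map_zero])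
    exact_mod_cast h3
  haveI : (𝔓₂.under (𝓞 k)).IsPrime := Ideal.IsPrime.under (𝓞 k) 𝔓₂
  let w : HeightOneSpectrum (𝓞 k) := ⟨𝔓₂.under (𝓞 k), inferInstance, hne⟩
  refine ⟨𝔓₂, w, h2prime, ⟨rfl⟩, ?_, ?_⟩
  · -- `w ∩ 𝓞 k₀ = v₀`
    ext r
    rw [Ideal.under_def, Ideal.mem_comap]
    exact hmem r
  · -- inertia
    intro j g hjg hg
    rw [Ideal.inertia, AddSubgroup.mem_inertia] at hg ⊢
    intro y
    change j • y - y ∈ Ideal.comap ψ 𝔓₁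
    rw [Ideal.mem_comap, map_sub]
    have key : ψ (j • y) = g • ψ y := by
      apply Subtype.ext
      rw [hψ, integralClosure.coe_smul, integralClosure.coe_smul, hψ, AlgEquiv.smul_def,
        AlgEquiv.smul_def]
      exact hjg y
    rw [key]
    exact hg (ψ y)

end Rebase

/-! ## §4 An inertia element of `Γ_ℚ` above an odd prime `p` moving a `p`-th root of unity -/

section CyclotomicInertia

open Literature.NumberTheory.EllipticCurves Rat.HeightOneSpectrum


/-- **An inertia element of `Γ_ℚ` above the odd prime `p` that moves a `p`-th root of unity.**  There
are: the place `v` of `ℚ` at `p`, a prime `𝔓 ∣ v` of `\bar ℤ`, `τ ∈ I_𝔓 ≤ Γ_ℚ` and `ζ ∈ ℚ̄` with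
`ζ^p = 1` and `τ ζ ≠ ζ`.  Construction: a LOCAL inertia element `σ ∈ I(ℚ̄_p/ℚ_p)` with mod-`p`
cyclotomic character `-1 ≠ 1` (Serre, *Local Fields* IV §4: `χ̄_p(I_p) = 𝔽_pˣ`; tree
`Rat.exists_mem_absInertia_adicCompletion_modPCyclotomicCharacterZMod_eq`), restricted to `Γ_ℚ` along the
chosen embedding `ℚ̄ → ℚ̄_p` (lands in `I_𝔓`, Neukirch II (9.6); tree `resGalOfEmb_mem_inertia_primeBelow`);
on a primitive `p`-th root `ζ` it acts by `ζ ↦ ζ^{p-1} ≠ ζ`.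
[cite: SerreLocalFields1979, Ch. IV §4, Prop. 17–18] [cite: NeukirchANT1999, Ch. II (9.6)] -/
theorem exists_mem_inertia_smul_ne {p : ℕ} (hp : p.Prime) (hp2 : p ≠ 2) :
    ∃ (v : HeightOneSpectrum (𝓞 ℚ)) (𝔓 : Ideal (absIntegers (𝓞 ℚ) ℚ)) (τ : absoluteGaloisGroup ℚ)
      (ζ : AlgebraicClosure ℚ),
      (p : 𝓞 ℚ) ∈ v.asIdeal ∧ 𝔓 ∈ v.primesAbove ∧ τ ∈ 𝔓.inertia (absoluteGaloisGroup ℚ) ∧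
      ζ ^ p = 1 ∧ τ • ζ ≠ ζ := by
  haveI : Fact p.Prime := ⟨hp⟩
  -- the place `v` of `ℚ` at `p`
  set v : HeightOneSpectrum (𝓞 ℚ) := primesEquiv.symm ⟨p, hp⟩ with hvdef
  have hv : ((primesEquiv v : Nat.Primes) : ℕ) = p := by rw [hvdef, Equiv.apply_symm_apply]
  have hpv : (p : 𝓞 ℚ) ∈ v.asIdeal := by
    refine (Rat.natCast_mem_asIdeal_iff v).mpr ?_
    change (primesEquiv v : ℕ) ∣ p
    rw [hv]
  -- a local inertia element with cyclotomic character `-1`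
  haveI : NeZero ((p : ℕ) : v.adicCompletion ℚ) := ⟨by
    haveI : CharZero (v.adicCompletion ℚ) :=
      charZero_of_injective_algebraMap (algebraMap ℚ (v.adicCompletion ℚ)).injective
    exact_mod_cast hp.ne_zero⟩
  have hu : (-1 : (ZMod p)ˣ) ≠ 1 := by
    intro h
    have h1 : ((-1 : (ZMod p)ˣ) : ZMod p) = ((1 : (ZMod p)ˣ) : ZMod p) := by rw [h]
    rw [Units.val_neg, Units.val_one] at h1
    have h2 : ((2 : ℕ) : ZMod p) = 0 := by
      have := congrArg (· + 1) h1
      simp only [neg_add_cancel] at this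
      exact_mod_cast this.symm
    rw [ZMod.natCast_eq_zero_iff] at h2
    exact hp2 ((Nat.prime_dvd_prime_iff_eq hp Nat.prime_two).mp h2)
  obtain ⟨σ, hσI, hσu⟩ :=
    Rat.exists_mem_absInertia_adicCompletion_modPCyclotomicCharacterZMod_eq v hv (-1 : (ZMod p)ˣ)
  -- into the inertia group of a prime of the local absolute integers, then of `\bar ℤ`
  obtain ⟨𝔐, h𝔐⟩ := v.localPrimesAbove_nonempty
  obtain ⟨w, hw⟩ := v.exists_spectralValuation
  have hσ𝔐 : σ ∈ 𝔐.inertia (absoluteGaloisGroup (v.adicCompletion ℚ)) := by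
    rw [HeightOneSpectrum.inertia_eq_absInertia hw h𝔐]; exact hσI
  set ι := closureEmb (K := ℚ) (v.adicCompletion ℚ) with hι
  have happly : ∀ x : AlgebraicClosure ℚ, ι (resGalOfEmb ι σ • x) = σ • ι x := fun x ↦ by
    have h := apply_resGalAuxOfEmb_apply ι σ x
    rw [← resGalOfEmb_apply] at h
    exact h
  -- a primitive `p`-th root of unity in `ℚ̄`
  have hq0 : ((p : ℕ) : AlgebraicClosure ℚ) ≠ 0 := by exact_mod_cast hp.ne_zero
  haveI : NeZero ((p : ℕ) : AlgebraicClosure ℚ) := ⟨hq0⟩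
  obtain ⟨ζ, hζ⟩ := IsAlgClosed.exists_root (Polynomial.cyclotomic p (AlgebraicClosure ℚ))
    (Polynomial.degree_cyclotomic_pos p _ hp.pos).ne'
  have hprim : IsPrimitiveRoot ζ p := Polynomial.isRoot_cyclotomic_iff.mp hζ
  refine ⟨v, v.primeBelow ι 𝔐, resGalOfEmb ι σ, ζ, hpv, v.primeBelow_mem_primesAbove (ι := ι) h𝔐,
    v.resGalOfEmb_mem_inertia_primeBelow ι 𝔐 hσ𝔐, hprim.pow_eq_one, fun heq ↦ ?_⟩
  -- `σ (ι ζ) = (ι ζ)^(p-1)` but `τ ζ = ζ`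
  have hspec := modPCyclotomicCharacterZMod_spec (v.adicCompletion ℚ) p σ (ι ζ)
    (by rw [← map_pow, hprim.pow_eq_one, map_one])
  rw [hσu, ← happly, heq] at hspec
  have hinj : Function.Injective ι := ι.toRingHom.injective
  have h1 : ζ = ζ ^ ((-1 : (ZMod p)ˣ) : ZMod p).val := hinj (by rw [map_pow]; exact hspec)
  rw [Units.val_neg, Units.val_one, ZMod.val_neg_of_ne_zero, ZMod.val_one] at h1
  have h2 := hprim.pow_inj (i := 1) (j := p - 1) hp.one_lt (Nat.sub_lt hp.pos Nat.one_pos)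
    (by rw [pow_one]; exact h1)
  have := hp.two_le
  omega

end CyclotomicInertia

end Summit.BirchSwinnertonDyer.Rank1Residual.X11b.InertiaTransport

end
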